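import Summits.ResolutionOfSingularities.ResolutionOfSingularities.Theorems.PurelyInseparableDim4E2OfCJSModel
import HarnessLib

/-!
# The p-PROGRAM of the E2 dictionary, row (M-a_p): the GLOBAL MODEL of a frame chain at EVERY prime `p`
# («for every prime p ≥ 3: no isolated cone-two chain over K̄ ⟸ CJS Thm 6.40», cell `res-dim4-pi`, WORD #66)

[OURS · counted 0 · AI work weaker than expert review.]  Cell `res-dim4-pi` (D-0157 DOOR 2), seat `res-dim4-p-2`
g2 (holder).  NOTHING here proves `ModelRowP p`, CJS Thm. 6.40, K2(p) or resolution of singularities in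
dimension ≥ 4 / characteristic `p`.

The p = 3 file `…E2OfCJSModel` (p665319) with `3 ↦ p` and NOTHING else — its engine, typ-3's
`Equimultiple.exists_chart_step'` (p656862), was stated for every prime `p` from the start (`[Fact p.Prime]
[CharP K p] [PerfectRing K p]`, `hmult : M.mult = p`, `hypSheaf p`, `CentreBlowup.step p`):

* §1 `GStageP K p F` — a stage (ambient, marked ideal of multiplicity `p`, closed point, open-immersion chart on
  which the marked ideal reads `(z^p + F)·𝒪`), `GStageP.init`, `GStageP.next` (+ `next_Z`, `next_π_x`, `next_M`);
* §2 `GStageP.tower p c hc` along a `Step0 p` chain (+ `towerπ`, `isBlowup_towerπ`, `tower_succ_M`, `towerπ_x`);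
* §3 **`globalModelP`** (`[CharP K p] [PerfectRing K p]`) and **`globalModelP_of_coneTwoChain`** (`K`
  algebraically closed; the binder of res-dim4-p-3 g2's `ModelRowP p`).

bears_on: LADDER-RESOLUTION:D157-DOOR2 (res-dim4-pi · F4-I(p,p) · CJS dictionary · row M-a_p).  Supports
stmt-ResolutionOfSingularities-16155 (helper).
-/

set_option linter.dupNamespace false -- mandated namespace of this single-conjunct summit

noncomputable section

open CategoryTheory AlgebraicGeometry TopologicalSpace
open Literature.AlgebraicGeometry.Resolution
open Literature.AlgebraicGeometry.Resolution.Hauser2010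
open Literature.AlgebraicGeometry.Resolution.AffinePointBlowup (P A ξ)
open Scheme.IdealSheafData

namespace Summit.ResolutionOfSingularities.ResolutionOfSingularities.Theorems.PIDim4

namespace E2OfCJS

/-! ## §1 Stages of the global model -/

/-- [OURS] **A STAGE of the global model** over `K`, carrying the residual polynomial `F`: an ambient `Z`
(locally noetherian, Jacobson), a marked ideal `M` of multiplicity `p`, a CLOSED point `x`, and an
open-immersion chart `φ : 𝔸⁵_K ⟶ Z` at `x` on which `M` reads `(z^p + F)·𝒪` (typ-3's INVARIANT of
`…PointStepPackage`). [folklore] -/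
structure GStageP (K : Type) [Field K] (p : ℕ) (F : MvPolynomial (Fin 4) K) : Type 1 where
  /-- the ambient -/
  Z : Scheme.{0}
  /-- the ambient is locally noetherian -/
  ln : IsLocallyNoetherian Z
  /-- the ambient is Jacobson (closed points of open charts are closed) -/
  js : JacobsonSpace Z
  /-- the marked ideal -/
  M : MarkedIdeal Z
  /-- of multiplicity `p` -/
  hmult : M.mult = p
  /-- the marked point -/
  x : Z
  /-- it is closed -/
  hx : IsClosed ({x} : Set Z)
  /-- the chart -/
  φ : P 4 K ⟶ Z
  /-- the chart is an open immersion -/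
  oi : IsOpenImmersion φ
  /-- the chart is centred at `x` -/
  hφ : φ (ξ 4 K) = x
  /-- on the chart the marked ideal is `(z^p + F)·𝒪` -/
  hM : M.ideal.comap φ = hypSheaf p F

namespace GStageP

variable {K : Type} [Field K] {p : ℕ}

variable (p) in
/-- **The initial stage**: `𝔸⁵_K` itself, `M = ((z^p + F)·𝒪, ∅, p)`, the origin, the identity chart. [folklore] -/
def init (F : MvPolynomial (Fin 4) K) : GStageP K p F where
  Z := P 4 K
  ln := inferInstance
  js := inferInstance
  M := ⟨hypSheaf p F, [], p⟩
  hmult := rfl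
  x := ξ 4 K
  hx := AffinePointBlowup.isClosed_ξ 4 K
  φ := 𝟙 (P 4 K)
  oi := inferInstance
  hφ := rfl
  hM := Scheme.IdealSheafData.comap_id _

/-- The point centre of a stage: the reduced closed point `x`. [folklore] -/
def centre {F : MvPolynomial (Fin 4) K} (G : GStageP K p F) : G.Z.IdealSheafData :=
  vanishingIdeal ⟨{G.x}, G.hx⟩

variable [Fact p.Prime] [CharP K p] [PerfectRing K p] [DecidableEq K]

/-- The chart datum of the next stage (typ-3's `exists_chart_step'` over the chosen blow-up of `x`).
[cite: BierstoneGrigorievMilmanWlodarczyk2011, §3.2 and Lemma 8.0.3 (2)] -/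
theorem exists_next_chart {F : MvPolynomial (Fin 4) K} (G : GStageP K p F) (s : State K) (hs : s.F = F)
    (hperm : (p : ℕ∞) ≤ CentreBlowup.ordAlong (Finset.univ : Finset (Fin 4)) s.F) (j : Fin 4)
    {b : Fin 4 → K} (hbj : b j = 0) :
    ∃ (φ' : P 4 K ⟶ blowup G.centre) (_ : IsOpenImmersion φ'),
      blowup.π G.centre (φ' (ξ 4 K)) = G.x ∧
        (G.M.transform (blowup.π G.centre) G.centre).ideal.comap φ' =
          hypSheaf p (CentreBlowup.step p Finset.univ j b s).F := by
  haveI := G.ln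
  haveI := G.oi
  exact Equimultiple.exists_chart_step' G.φ G.hx G.hφ G.M G.hmult s (hs ▸ G.hM) hperm
    (blowup.isBlowup G.centre) j hbj

/-- **The next stage**: blow up the closed point `x`, transform the marked ideal, re-chart at the point of the
edge `(j, b)`; the new marked point is closed (Jacobson). [folklore] -/
def next {F : MvPolynomial (Fin 4) K} (G : GStageP K p F) (s : State K) (hs : s.F = F)
    (hperm : (p : ℕ∞) ≤ CentreBlowup.ordAlong (Finset.univ : Finset (Fin 4)) s.F) (j : Fin 4)
    {b : Fin 4 → K} (hbj : b j = 0) (F' : MvPolynomial (Fin 4) K)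
    (hF' : (CentreBlowup.step p Finset.univ j b s).F = F') : GStageP K p F' := by
  haveI := G.ln
  haveI := G.js
  let h := G.exists_next_chart s hs hperm j hbj
  let φ' := h.choose
  haveI hoi : IsOpenImmersion φ' := h.choose_spec.choose
  have hφ' := h.choose_spec.choose_spec
  have hπ := blowup.isBlowup G.centre
  haveI : IsLocallyNoetherian (blowup G.centre) := by
    haveI := hπ.isProper
    exact LocallyOfFiniteType.isLocallyNoetherian (blowup.π G.centre)
  haveI hjs : JacobsonSpace ↥(blowup G.centre) := Equimultiple.jacobsonSpace_of_isBlowup' hπ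
  exact
    { Z := blowup G.centre
      ln := inferInstance
      js := hjs
      M := G.M.transform (blowup.π G.centre) G.centre
      hmult := by rw [MarkedIdeal.transform_mult]; exact G.hmult
      x := φ' (ξ 4 K)
      hx := by
        -- `ξ` is closed in `𝔸⁵`; an open immersion into a Jacobson space pulls closed points back to closed points
        have hmem : ξ 4 K ∈ (φ' : P 4 K → blowup G.centre) ⁻¹' closedPoints (blowup G.centre) := by
          rw [φ'.isOpenEmbedding.preimage_closedPoints]
          exact AffinePointBlowup.isClosed_ξ 4 K
        exact hmem
      φ := φ'
      oi := hoi
      hφ := rfl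
      hM := by rw [← hF']; exact hφ'.2 }

/-- The next stage's ambient IS the chosen blow-up of `x`. [folklore] -/
theorem next_Z {F : MvPolynomial (Fin 4) K} (G : GStageP K p F) (s : State K) (hs : s.F = F)
    (hperm : (p : ℕ∞) ≤ CentreBlowup.ordAlong (Finset.univ : Finset (Fin 4)) s.F) (j : Fin 4)
    {b : Fin 4 → K} (hbj : b j = 0) (F' : MvPolynomial (Fin 4) K)
    (hF' : (CentreBlowup.step p Finset.univ j b s).F = F') :
    (G.next s hs hperm j hbj F' hF').Z = blowup G.centre := rfl

/-- `π_G : Bl_x(Z) ⟶ Z` maps the next marked point to `x`. [folklore] -/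
theorem next_π_x {F : MvPolynomial (Fin 4) K} (G : GStageP K p F) (s : State K) (hs : s.F = F)
    (hperm : (p : ℕ∞) ≤ CentreBlowup.ordAlong (Finset.univ : Finset (Fin 4)) s.F) (j : Fin 4)
    {b : Fin 4 → K} (hbj : b j = 0) (F' : MvPolynomial (Fin 4) K)
    (hF' : (CentreBlowup.step p Finset.univ j b s).F = F') :
    blowup.π G.centre ((G.next s hs hperm j hbj F' hF').x) = G.x :=
  (G.exists_next_chart s hs hperm j hbj).choose_spec.choose_spec.1

/-- The next marked ideal IS the transform of `M` under the blow-up of `x`. [folklore] -/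
theorem next_M {F : MvPolynomial (Fin 4) K} (G : GStageP K p F) (s : State K) (hs : s.F = F)
    (hperm : (p : ℕ∞) ≤ CentreBlowup.ordAlong (Finset.univ : Finset (Fin 4)) s.F) (j : Fin 4)
    {b : Fin 4 → K} (hbj : b j = 0) (F' : MvPolynomial (Fin 4) K)
    (hF' : (CentreBlowup.step p Finset.univ j b s).F = F') :
    (G.next s hs hperm j hbj F' hF').M = G.M.transform (blowup.π G.centre) G.centre := rfl

/-! ## §2 The tower along a `Step0 p` chain -/

variable (p) in
/-- **The tower of stages along a chain of point blow-ups of the frame** (`Step0 p (c k) (c (k+1))` for all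
`k`): stage `0` is `𝔸⁵_K` with `(z^p + (c 0).F)·𝒪`; stage `i + 1` blows up the marked point of stage `i` and
re-charts at the edge's point (the edge data `(j, b)` chosen from `Step0`). [folklore] -/
def tower (c : ℕ → State K) (hc : ∀ k, Step0 p (c k) (c (k + 1))) : ∀ i, GStageP K p (c i).F
  | 0 => init p (c 0).F
  | i + 1 =>
    (tower c hc i).next (c i) rfl (by exact_mod_cast (hc i).1) (hc i).2.choose
      (b := (hc i).2.choose_spec.choose) (hc i).2.choose_spec.choose_spec.2.1 (c (i + 1)).F
      (congrArg CentreBlowup.CState.F (hc i).2.choose_spec.choose_spec.2.2.2.2).symm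

variable (p) in
/-- The blow-up morphism between consecutive ambients of the tower. [folklore] -/
def towerπ (c : ℕ → State K) (hc : ∀ k, Step0 p (c k) (c (k + 1))) (i : ℕ) :
    (tower p c hc (i + 1)).Z ⟶ (tower p c hc i).Z :=
  blowup.π (tower p c hc i).centre

variable (p) in
/-- It IS a blowing up of the marked closed point. [folklore] -/
theorem isBlowup_towerπ (c : ℕ → State K) (hc : ∀ k, Step0 p (c k) (c (k + 1))) (i : ℕ) :
    IsBlowup (towerπ p c hc i) (tower p c hc i).centre :=
  blowup.isBlowup _

variable (p) in
/-- The marked ideals along the tower are the successive transforms. [folklore] -/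
theorem tower_succ_M (c : ℕ → State K) (hc : ∀ k, Step0 p (c k) (c (k + 1))) (i : ℕ) :
    (tower p c hc (i + 1)).M = (tower p c hc i).M.transform (towerπ p c hc i) (tower p c hc i).centre := rfl

variable (p) in
/-- The marked points lie over each other. [folklore] -/
theorem towerπ_x (c : ℕ → State K) (hc : ∀ k, Step0 p (c k) (c (k + 1))) (i : ℕ) :
    towerπ p c hc i (tower p c hc (i + 1)).x = (tower p c hc i).x :=
  next_π_x (tower p c hc i) (c i) rfl (by exact_mod_cast (hc i).1) _ _ _ _

end GStageP

/-! ## §3 (M-a) The global model of a frame chain -/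

/-- **(M-a) THE GLOBAL MODEL.** Over a field `K` of characteristic `p` that is a perfect ring for `p` (e.g.
algebraically closed), every chain `c` of the frame's point blow-ups (`Step0 p (c k) (c (k+1))`, all `k`) is
READ by an infinite tower of point blow-ups of ambients: locally noetherian Jacobson schemes `Z i`
(`Z 0 = 𝔸⁵_K`), marked ideals `M i` of multiplicity `p`, CLOSED points `x i`, open-immersion charts
`φ i : 𝔸⁵_K ⟶ Z i` with `φ i 0 = x i` and `(M i).ideal.comap (φ i) = hypSheaf p (c i).F`, and blowing ups
`π i : Z (i+1) ⟶ Z i` of `x i` with `M (i+1) = (M i).transform (π i) 𝓘_{x i}` and `π i (x (i+1)) = x i` —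
typ-3's point-centre INVARIANT (`…PointStepPackage`) propagated forever along the chain by
`Equimultiple.exists_chart_step'`. [OURS · sub-row (M-a) of the E2 transfer row]
[cite: BierstoneGrigorievMilmanWlodarczyk2011, §3.2 and Lemma 8.0.3 (2)] -/
theorem globalModelP (K : Type) [Field K] (p : ℕ) [Fact p.Prime] [CharP K p] [PerfectRing K p] [DecidableEq K] (c : ℕ → State K)
    (hc : ∀ k, Step0 p (c k) (c (k + 1))) :
    ∃ (Z : ℕ → Scheme.{0}) (_ : ∀ i, IsLocallyNoetherian (Z i)) (_ : ∀ i, JacobsonSpace ↥(Z i))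
      (M : ∀ i, MarkedIdeal (Z i)) (x : ∀ i, ↥(Z i)) (hx : ∀ i, IsClosed ({x i} : Set (Z i)))
      (φ : ∀ i, P 4 K ⟶ Z i) (_ : ∀ i, IsOpenImmersion (φ i)) (π : ∀ i, Z (i + 1) ⟶ Z i),
      ∀ i, (M i).mult = p ∧ (φ i) (ξ 4 K) = x i ∧ (M i).ideal.comap (φ i) = hypSheaf p (c i).F ∧
        IsBlowup (π i) (vanishingIdeal ⟨{x i}, hx i⟩) ∧
        M (i + 1) = (M i).transform (π i) (vanishingIdeal ⟨{x i}, hx i⟩) ∧ (π i) (x (i + 1)) = x i := by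
  let T := GStageP.tower p c hc
  exact ⟨fun i => (T i).Z, fun i => (T i).ln, fun i => (T i).js, fun i => (T i).M, fun i => (T i).x,
    fun i => (T i).hx, fun i => (T i).φ, fun i => (T i).oi, fun i => GStageP.towerπ p c hc i,
    fun i => ⟨(T i).hmult, (T i).hφ, (T i).hM, GStageP.isBlowup_towerπ p c hc i, GStageP.tower_succ_M p c hc i,
      GStageP.towerπ_x p c hc i⟩⟩

/-- **(M-a) for an E2-violating chain over an algebraically closed field** (the binder of `ModelRow`):
algebraically closed fields of characteristic `p` are perfect, and the E2 letters are not needed for the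
global model. [OURS · glue] [folklore] -/
theorem globalModelP_of_coneTwoChain (K : Type) [Field K] (p : ℕ) [Fact p.Prime] [CharP K p] [IsAlgClosed K]
    [DecidableEq K]
    (c : ℕ → State K)
    (hc : ∀ k, IsIsolated p (c k).F ∧ Step0 p (c k) (c (k + 1)) ∧ ordZero (c k).F = (p : ℕ∞) ∧
      RidgeBudget.ebar (c k).F = 2) :
    ∃ (Z : ℕ → Scheme.{0}) (_ : ∀ i, IsLocallyNoetherian (Z i)) (_ : ∀ i, JacobsonSpace ↥(Z i))
      (M : ∀ i, MarkedIdeal (Z i)) (x : ∀ i, ↥(Z i)) (hx : ∀ i, IsClosed ({x i} : Set (Z i)))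
      (φ : ∀ i, P 4 K ⟶ Z i) (_ : ∀ i, IsOpenImmersion (φ i)) (π : ∀ i, Z (i + 1) ⟶ Z i),
      ∀ i, (M i).mult = p ∧ (φ i) (ξ 4 K) = x i ∧ (M i).ideal.comap (φ i) = hypSheaf p (c i).F ∧
        IsBlowup (π i) (vanishingIdeal ⟨{x i}, hx i⟩) ∧
        M (i + 1) = (M i).transform (π i) (vanishingIdeal ⟨{x i}, hx i⟩) ∧ (π i) (x (i + 1)) = x i :=
  globalModelP K p c fun k => (hc k).2.1

end E2OfCJS

end Summit.ResolutionOfSingularities.ResolutionOfSingularities.Theorems.PIDim4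

end
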